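import Mathlib
import HarnessLib
import Summits.ValiantsHypothesis.ValiantsHypothesis.Theorems.LacunarySymmetroidMatrixDescartesOsculationLawStubRankOne
import Summits.ValiantsHypothesis.ValiantsHypothesis.Theorems.LacunarySymmetroidMatrixDescartesOsculationLawTwoKRankOne
import Summits.ValiantsHypothesis.ValiantsHypothesis.Theorems.LacunarySymmetroidMatrixDescartesOsculationLawTwoKSupport
import Summits.ValiantsHypothesis.ValiantsHypothesis.Theorems.LacunarySymmetroidMatrixDescartesOsculationLawTwoKPencil

/-!
# ValiantsHypothesis / LacunarySymmetroid — crux `MatrixDescartes` (stmt-ValiantsHypothesis-18050, V1),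
# line `Cruxes/MatrixDescartes/Lines/osculation_law.lean` («osculation-law»): the RANK-ONE COLUMN of the osculation law

For the splitting `(r, s) = (1, s)` of `OsculationLawAt (s+1) K B` (insertion of a RANK-ONE semidefinite letter into
a symmetric pencil of any size `m = s + 1`), the landed `OsculationRankOne.stub_rankOne` bounds the osculation
count by the positive zeros of `R = W(f)·a² − W(a)·f²` (`f = det G`, `a = det G₂₂`).  By the Leibniz expansion
the exponents of `det` of an `n × n` pencil with exponent set `E` lie in the `n`-fold sumset `n • E`
(`supp_det_pencil`), so `supp R ⊆ (4s + 2) • E` and Descartes' rule with multiplicity gives the explicit column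

  `osculationLawAt_rankOne (s K) : … (osculationSet d S).Finite → (osculationSet d S).ncard ≤ K ^ (4 * s + 2)`

for every `s`, `K` (the line's vocabulary UNFOLDED verbatim; at `s = 1` this sharpens the constant of
`osculationLawAt_two_rankOne` from `16 K⁶` to `K⁶`).

Honest framing.  A located COLUMN (rank-one peels, every size) of an UNREGISTERED V1 law line with a Descartes
ceiling that is polynomial in `K` for each fixed size but NOT inside the law's envelope `2^(C (K + log₂² m))`
uniformly in `m` (`K^(4m−2)` versus `2^(CK)`): it backs the rank-one rows of the instrument, it is not the law.
`OsculationLaw`, `PeelInequality` (`r ≥ 2`), `stub_recursion`, `MatrixDescartes`, Conjecture B and `VP ≠ VNP` stay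
OPEN / NOT proved.  No definitions, no named facts; Mathlib only.
-/

-- `Summit.ValiantsHypothesis.ValiantsHypothesis.…` is the tree's mandated single-conjunct layout (Sub = Summit).
set_option linter.dupNamespace false

noncomputable section

namespace Summit.ValiantsHypothesis.ValiantsHypothesis.Theorems.LacunarySymmetroidMatrixDescartes

open Polynomial Matrix
open scoped BigOperators Pointwise

namespace OsculationTwoK

/-! ### Supports of sums, products and determinants -/

/-- Integer constants do not enlarge the support. [folklore] -/
theorem supp_intCast_mul {S : Finset ℕ} {p : ℝ[X]} (n : ℤ) (hp : p.support ⊆ S) :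
    ((n : ℝ[X]) * p).support ⊆ S := by
  rw [← zsmul_eq_mul]
  exact (support_smul _ _).trans hp

/-- Finite sums stay inside a common support set. [folklore] -/
theorem supp_sum {ι : Type*} (s : Finset ι) (f : ι → ℝ[X]) {S : Finset ℕ}
    (h : ∀ i ∈ s, (f i).support ⊆ S) : (∑ i ∈ s, f i).support ⊆ S :=
  Finset.sum_induction f (fun p => p.support ⊆ S) (fun _ _ ha hb => OsculationCusp.supp_add ha hb)
    (by simp) h

/-- Finite products add the sumset weights. [folklore] -/
theorem supp_prod {ι : Type*} (s : Finset ι) (f : ι → ℝ[X]) {E : Finset ℕ} {m : ℕ}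
    (h : ∀ i ∈ s, (f i).support ⊆ m • E) : (∏ i ∈ s, f i).support ⊆ (s.card * m) • E := by
  classical
  induction s using Finset.cons_induction with
  | empty =>
    intro n hn
    rw [Finset.prod_empty, ← C_1, support_C one_ne_zero, Finset.mem_singleton] at hn
    rw [Finset.card_empty, zero_mul, zero_nsmul, hn]
    exact Finset.zero_mem_zero
  | cons a s ha ih =>
    rw [Finset.prod_cons, Finset.card_cons]
    have h1 := h a (Finset.mem_cons_self a s)
    have h2 := ih (fun i hi => h i (Finset.mem_cons_of_mem hi))
    exact OsculationCusp.supp_cast (OsculationCusp.supp_mul h1 h2) (by ring)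

/-- Leibniz: the exponents of `det` of an `n × n` pencil lie in the `n`-fold sumset of its exponent set.
[folklore] -/
theorem supp_det_pencil {ι : Type*} [Fintype ι] [DecidableEq ι] {K : ℕ} (d : Fin K → ℕ)
    (T : Fin K → Matrix ι ι ℝ) :
    ((∑ l, (X : ℝ[X]) ^ d l • (T l).map Polynomial.C).det).support ⊆
      Fintype.card ι • Finset.univ.image d := by
  rw [Matrix.det_apply']
  refine supp_sum _ _ fun σ _ => supp_intCast_mul _ ?_
  have h := supp_prod Finset.univ (fun i => (∑ l, (X : ℝ[X]) ^ d l • (T l).map Polynomial.C) (σ i) i)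
    (fun i _ => support_pencil_apply d T (σ i) i)
  exact OsculationCusp.supp_cast h (by rw [Finset.card_univ, mul_one])

/-! ### The rank-one column -/

/-- **The rank-one column of the osculation law.**  For every `s`, `K`, every exponent vector `d` and every
symmetric block pencil `S : Fin K → Matrix (Fin 1 ⊕ Fin s) (Fin 1 ⊕ Fin s) ℝ`: if the osculation set of the
spectral curve `det(Σ_l t^(d l) S_l + b·(I₁ ⊕ 0)) = 0` (the line's `osculationSet d S`, UNFOLDED verbatim) is
finite, it has at most `K ^ (4s + 2)` points — the `(1, s)` splitting of `OsculationLawAt (s + 1) K (K ^ (4s+2))`. -/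
theorem osculationLawAt_rankOne (s K : ℕ) (d : Fin K → ℕ) (S : Fin K → Matrix (Fin 1 ⊕ Fin s) (Fin 1 ⊕ Fin s) ℝ)
    (hS : ∀ l, (S l).IsSymm)
    (hfin : {p : Fin 2 → ℝ | 0 < p 0 ∧ 0 < p 1 ∧ MvPolynomial.eval p (∑ l, (MvPolynomial.X (0 : Fin 2) : MvPolynomial (Fin 2) ℝ) ^ d l •
              (S l).map (MvPolynomial.C : ℝ →+* MvPolynomial (Fin 2) ℝ)
            + (MvPolynomial.X (1 : Fin 2) : MvPolynomial (Fin 2) ℝ) •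
              (Matrix.fromBlocks 1 0 0 0 : Matrix (Fin 1 ⊕ Fin s) (Fin 1 ⊕ Fin s) ℝ).map
                (MvPolynomial.C : ℝ →+* MvPolynomial (Fin 2) ℝ)).det = 0 ∧
      MvPolynomial.eval p
        (MvPolynomial.X 0 * MvPolynomial.pderiv 0 (MvPolynomial.X 0 * MvPolynomial.pderiv 0 (∑ l, (MvPolynomial.X (0 : Fin 2) : MvPolynomial (Fin 2) ℝ) ^ d l •
              (S l).map (MvPolynomial.C : ℝ →+* MvPolynomial (Fin 2) ℝ)
            + (MvPolynomial.X (1 : Fin 2) : MvPolynomial (Fin 2) ℝ) •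
              (Matrix.fromBlocks 1 0 0 0 : Matrix (Fin 1 ⊕ Fin s) (Fin 1 ⊕ Fin s) ℝ).map
                (MvPolynomial.C : ℝ →+* MvPolynomial (Fin 2) ℝ)).det)
            * (MvPolynomial.X 1 * MvPolynomial.pderiv 1 (∑ l, (MvPolynomial.X (0 : Fin 2) : MvPolynomial (Fin 2) ℝ) ^ d l •
              (S l).map (MvPolynomial.C : ℝ →+* MvPolynomial (Fin 2) ℝ)
            + (MvPolynomial.X (1 : Fin 2) : MvPolynomial (Fin 2) ℝ) •
              (Matrix.fromBlocks 1 0 0 0 : Matrix (Fin 1 ⊕ Fin s) (Fin 1 ⊕ Fin s) ℝ).map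
                (MvPolynomial.C : ℝ →+* MvPolynomial (Fin 2) ℝ)).det) ^ 2
          - 2 * (MvPolynomial.X 0 * MvPolynomial.pderiv 0 (MvPolynomial.X 1 * MvPolynomial.pderiv 1 (∑ l, (MvPolynomial.X (0 : Fin 2) : MvPolynomial (Fin 2) ℝ) ^ d l •
              (S l).map (MvPolynomial.C : ℝ →+* MvPolynomial (Fin 2) ℝ)
            + (MvPolynomial.X (1 : Fin 2) : MvPolynomial (Fin 2) ℝ) •
              (Matrix.fromBlocks 1 0 0 0 : Matrix (Fin 1 ⊕ Fin s) (Fin 1 ⊕ Fin s) ℝ).map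
                (MvPolynomial.C : ℝ →+* MvPolynomial (Fin 2) ℝ)).det))
            * (MvPolynomial.X 0 * MvPolynomial.pderiv 0 (∑ l, (MvPolynomial.X (0 : Fin 2) : MvPolynomial (Fin 2) ℝ) ^ d l •
              (S l).map (MvPolynomial.C : ℝ →+* MvPolynomial (Fin 2) ℝ)
            + (MvPolynomial.X (1 : Fin 2) : MvPolynomial (Fin 2) ℝ) •
              (Matrix.fromBlocks 1 0 0 0 : Matrix (Fin 1 ⊕ Fin s) (Fin 1 ⊕ Fin s) ℝ).map
                (MvPolynomial.C : ℝ →+* MvPolynomial (Fin 2) ℝ)).det) * (MvPolynomial.X 1 * MvPolynomial.pderiv 1 (∑ l, (MvPolynomial.X (0 : Fin 2) : MvPolynomial (Fin 2) ℝ) ^ d l •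
              (S l).map (MvPolynomial.C : ℝ →+* MvPolynomial (Fin 2) ℝ)
            + (MvPolynomial.X (1 : Fin 2) : MvPolynomial (Fin 2) ℝ) •
              (Matrix.fromBlocks 1 0 0 0 : Matrix (Fin 1 ⊕ Fin s) (Fin 1 ⊕ Fin s) ℝ).map
                (MvPolynomial.C : ℝ →+* MvPolynomial (Fin 2) ℝ)).det)
          + MvPolynomial.X 1 * MvPolynomial.pderiv 1 (MvPolynomial.X 1 * MvPolynomial.pderiv 1 (∑ l, (MvPolynomial.X (0 : Fin 2) : MvPolynomial (Fin 2) ℝ) ^ d l •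
              (S l).map (MvPolynomial.C : ℝ →+* MvPolynomial (Fin 2) ℝ)
            + (MvPolynomial.X (1 : Fin 2) : MvPolynomial (Fin 2) ℝ) •
              (Matrix.fromBlocks 1 0 0 0 : Matrix (Fin 1 ⊕ Fin s) (Fin 1 ⊕ Fin s) ℝ).map
                (MvPolynomial.C : ℝ →+* MvPolynomial (Fin 2) ℝ)).det)
            * (MvPolynomial.X 0 * MvPolynomial.pderiv 0 (∑ l, (MvPolynomial.X (0 : Fin 2) : MvPolynomial (Fin 2) ℝ) ^ d l •
              (S l).map (MvPolynomial.C : ℝ →+* MvPolynomial (Fin 2) ℝ)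
            + (MvPolynomial.X (1 : Fin 2) : MvPolynomial (Fin 2) ℝ) •
              (Matrix.fromBlocks 1 0 0 0 : Matrix (Fin 1 ⊕ Fin s) (Fin 1 ⊕ Fin s) ℝ).map
                (MvPolynomial.C : ℝ →+* MvPolynomial (Fin 2) ℝ)).det) ^ 2) = 0}.Finite) :
    {p : Fin 2 → ℝ | 0 < p 0 ∧ 0 < p 1 ∧ MvPolynomial.eval p (∑ l, (MvPolynomial.X (0 : Fin 2) : MvPolynomial (Fin 2) ℝ) ^ d l •
              (S l).map (MvPolynomial.C : ℝ →+* MvPolynomial (Fin 2) ℝ)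
            + (MvPolynomial.X (1 : Fin 2) : MvPolynomial (Fin 2) ℝ) •
              (Matrix.fromBlocks 1 0 0 0 : Matrix (Fin 1 ⊕ Fin s) (Fin 1 ⊕ Fin s) ℝ).map
                (MvPolynomial.C : ℝ →+* MvPolynomial (Fin 2) ℝ)).det = 0 ∧
      MvPolynomial.eval p
        (MvPolynomial.X 0 * MvPolynomial.pderiv 0 (MvPolynomial.X 0 * MvPolynomial.pderiv 0 (∑ l, (MvPolynomial.X (0 : Fin 2) : MvPolynomial (Fin 2) ℝ) ^ d l •
              (S l).map (MvPolynomial.C : ℝ →+* MvPolynomial (Fin 2) ℝ)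
            + (MvPolynomial.X (1 : Fin 2) : MvPolynomial (Fin 2) ℝ) •
              (Matrix.fromBlocks 1 0 0 0 : Matrix (Fin 1 ⊕ Fin s) (Fin 1 ⊕ Fin s) ℝ).map
                (MvPolynomial.C : ℝ →+* MvPolynomial (Fin 2) ℝ)).det)
            * (MvPolynomial.X 1 * MvPolynomial.pderiv 1 (∑ l, (MvPolynomial.X (0 : Fin 2) : MvPolynomial (Fin 2) ℝ) ^ d l •
              (S l).map (MvPolynomial.C : ℝ →+* MvPolynomial (Fin 2) ℝ)
            + (MvPolynomial.X (1 : Fin 2) : MvPolynomial (Fin 2) ℝ) •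
              (Matrix.fromBlocks 1 0 0 0 : Matrix (Fin 1 ⊕ Fin s) (Fin 1 ⊕ Fin s) ℝ).map
                (MvPolynomial.C : ℝ →+* MvPolynomial (Fin 2) ℝ)).det) ^ 2
          - 2 * (MvPolynomial.X 0 * MvPolynomial.pderiv 0 (MvPolynomial.X 1 * MvPolynomial.pderiv 1 (∑ l, (MvPolynomial.X (0 : Fin 2) : MvPolynomial (Fin 2) ℝ) ^ d l •
              (S l).map (MvPolynomial.C : ℝ →+* MvPolynomial (Fin 2) ℝ)
            + (MvPolynomial.X (1 : Fin 2) : MvPolynomial (Fin 2) ℝ) •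
              (Matrix.fromBlocks 1 0 0 0 : Matrix (Fin 1 ⊕ Fin s) (Fin 1 ⊕ Fin s) ℝ).map
                (MvPolynomial.C : ℝ →+* MvPolynomial (Fin 2) ℝ)).det))
            * (MvPolynomial.X 0 * MvPolynomial.pderiv 0 (∑ l, (MvPolynomial.X (0 : Fin 2) : MvPolynomial (Fin 2) ℝ) ^ d l •
              (S l).map (MvPolynomial.C : ℝ →+* MvPolynomial (Fin 2) ℝ)
            + (MvPolynomial.X (1 : Fin 2) : MvPolynomial (Fin 2) ℝ) •
              (Matrix.fromBlocks 1 0 0 0 : Matrix (Fin 1 ⊕ Fin s) (Fin 1 ⊕ Fin s) ℝ).map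
                (MvPolynomial.C : ℝ →+* MvPolynomial (Fin 2) ℝ)).det) * (MvPolynomial.X 1 * MvPolynomial.pderiv 1 (∑ l, (MvPolynomial.X (0 : Fin 2) : MvPolynomial (Fin 2) ℝ) ^ d l •
              (S l).map (MvPolynomial.C : ℝ →+* MvPolynomial (Fin 2) ℝ)
            + (MvPolynomial.X (1 : Fin 2) : MvPolynomial (Fin 2) ℝ) •
              (Matrix.fromBlocks 1 0 0 0 : Matrix (Fin 1 ⊕ Fin s) (Fin 1 ⊕ Fin s) ℝ).map
                (MvPolynomial.C : ℝ →+* MvPolynomial (Fin 2) ℝ)).det)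
          + MvPolynomial.X 1 * MvPolynomial.pderiv 1 (MvPolynomial.X 1 * MvPolynomial.pderiv 1 (∑ l, (MvPolynomial.X (0 : Fin 2) : MvPolynomial (Fin 2) ℝ) ^ d l •
              (S l).map (MvPolynomial.C : ℝ →+* MvPolynomial (Fin 2) ℝ)
            + (MvPolynomial.X (1 : Fin 2) : MvPolynomial (Fin 2) ℝ) •
              (Matrix.fromBlocks 1 0 0 0 : Matrix (Fin 1 ⊕ Fin s) (Fin 1 ⊕ Fin s) ℝ).map
                (MvPolynomial.C : ℝ →+* MvPolynomial (Fin 2) ℝ)).det)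
            * (MvPolynomial.X 0 * MvPolynomial.pderiv 0 (∑ l, (MvPolynomial.X (0 : Fin 2) : MvPolynomial (Fin 2) ℝ) ^ d l •
              (S l).map (MvPolynomial.C : ℝ →+* MvPolynomial (Fin 2) ℝ)
            + (MvPolynomial.X (1 : Fin 2) : MvPolynomial (Fin 2) ℝ) •
              (Matrix.fromBlocks 1 0 0 0 : Matrix (Fin 1 ⊕ Fin s) (Fin 1 ⊕ Fin s) ℝ).map
                (MvPolynomial.C : ℝ →+* MvPolynomial (Fin 2) ℝ)).det) ^ 2) = 0}.ncard ≤ K ^ (4 * s + 2) := by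
  classical
  refine (OsculationRankOne.stub_rankOne s K d S hS hfin).trans ?_
  refine (OsculationRankOne.card_roots_filter_pos_le_card_support _).trans ?_
  have hEK : (Finset.univ.image d).card ≤ K := (Finset.card_image_le).trans (by simp)
  -- `f = det G` on `Fin 1 ⊕ Fin s`, `a = det G₂₂` on `Fin s`
  have hf : ((∑ l, (X : ℝ[X]) ^ d l • (S l).map Polynomial.C).det).support ⊆ (s + 1) • Finset.univ.image d :=
    OsculationCusp.supp_cast (supp_det_pencil d S) (by simp [Fintype.card_sum, Fintype.card_fin]; ring)
  have ha : ((∑ l, (X : ℝ[X]) ^ d l • ((S l).toBlocks₂₂).map Polynomial.C).det).support ⊆ s • Finset.univ.image d :=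
    OsculationCusp.supp_cast (supp_det_pencil d (fun l => (S l).toBlocks₂₂)) (by simp [Fintype.card_fin])
  have hf1 := OsculationCusp.supp_theta hf
  have hf2 := OsculationCusp.supp_theta hf1
  have ha1 := OsculationCusp.supp_theta ha
  have ha2 := OsculationCusp.supp_theta ha1
  have hWf := OsculationCusp.supp_sub (OsculationCusp.supp_mul hf hf2)
    (OsculationCusp.supp_cast (OsculationCusp.supp_pow hf1 2 (by norm_num)) (by ring))
  have hWa := OsculationCusp.supp_sub (OsculationCusp.supp_mul ha ha2)
    (OsculationCusp.supp_cast (OsculationCusp.supp_pow ha1 2 (by norm_num)) (by ring))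
  have hR := OsculationCusp.supp_sub
    (OsculationCusp.supp_cast (n := 4 * s + 2)
      (OsculationCusp.supp_mul hWf (OsculationCusp.supp_pow ha 2 (by norm_num))) (by ring))
    (OsculationCusp.supp_cast (n := 4 * s + 2)
      (OsculationCusp.supp_mul hWa (OsculationCusp.supp_pow hf 2 (by norm_num))) (by ring))
  exact (OsculationCusp.card_support_le_of_subset_nsmul hR).trans (Nat.pow_le_pow_left hEK _)

end OsculationTwoK

end Summit.ValiantsHypothesis.ValiantsHypothesis.Theorems.LacunarySymmetroidMatrixDescartes
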